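import Mathlib
import Literature.AlgebraicGeometry.Resolution.CobordantTupleGame
import Literature.AlgebraicGeometry.Resolution.CobordantChartCoefficients
import Literature.AlgebraicGeometry.Resolution.CobordantChartPlaneSlice
import Literature.AlgebraicGeometry.Resolution.CobordantArcLemma
import Literature.AlgebraicGeometry.Resolution.FormalCoordinateChange
import Literature.AlgebraicGeometry.Resolution.NodalFamilyRingDomain
import Summits.ResolutionOfSingularities.ResolutionOfSingularities.Theorems.WeightedInvariantGlobalizeLocalDropCanonize
import Summits.ResolutionOfSingularities.ResolutionOfSingularities.Theorems.WeightedInvariantGlobalizeLocalDropCylinder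
import Summits.ResolutionOfSingularities.ResolutionOfSingularities.Theorems.WeightedInvariantLocalWeightedDropMonomialWon
import Summits.ResolutionOfSingularities.ResolutionOfSingularities.Theorems.WeightedInvariantLocalWeightedDropTrackCMonomialDivisor
import Summits.ResolutionOfSingularities.ResolutionOfSingularities.Theorems.WeightedInvariantLocalWeightedDropSpaceCountDefs
import Summits.ResolutionOfSingularities.ResolutionOfSingularities.Theorems.WeightedInvariantLocalWeightedDropPlaneMonomialPhaseAux

/-!
# `WeightedInvariant.LocalWeightedDrop`, line `tame-four-tuple-drop`: unit monomials in any number of variables under the cobordant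
# chart and the slice (the algebra of the monomial phase of the tuple game)

Crux item stmt-ResolutionOfSingularities-8899 `LocalWeightedDrop` (route `ResolutionOfSingularities/WeightedInvariant`); stub (B3)
`stub_spaceMonomialPhase` of strategist res-L1-w43-strat-1's line `tame-four-tuple-drop` (three variables; this file is dimension-generic:
`n + 1` variables).  [OURS · L1 W4.3, chain w43, unit res-L1-w43-stub-8 (seat res-D-pv-006); the dimension-generic form of the tree's
`…PlaneMonomialPhaseAux` (plane case); NOT a statement of any manuscript.]

A UNIT MONOMIAL is `u · ∏ᵢ xᵢ^{vᵢ}` with `u(0) ≠ 0`.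
* `germIsNC_prodSupport` — a tuple of unit monomials (and zeros) has a support product with normal-crossing support (`GermIsNC`);
* `exists_presentation` — if the support product of `a` has normal-crossing support in the coordinates `Φ`, every non-zero entry
  `a_j∘Φ` is a unit monomial in the SAME coordinates (divisors of unit monomials, `TrackC.exists_eq_unit_mul_monomial_of_dvd`);
* `marking_le_total`, `not_bad_of_total_lt` — badness read on the exponents;
* `subst_chart_unitMonomial`, `not_X_dvd_bracket`, `factor_eq` — `(u·∏ xᵢ^{vᵢ})(chart_{w,c}) = s^{Σ wᵢvᵢ} · [U · ∏ (cᵢ + y′ᵢ)^{vᵢ}]`,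
  `s ∤ [...]`: these ARE the factorisation data `(D_j, G_j)` of `TupleGame.StepDrop`;
* `slice_bracket` — at a live slot `l` (`c_l ≠ 0`) the slice `y′_l ↦ 0` of `s^N · [...]` is the unit monomial with exponents
  `N` on `s` and, on the variable coming from `x_{l.succAbove q}`, the old exponent if `c = 0` there and `0` if that coordinate became a unit;
* `newTuple_slot` — hence the successor tuple of a presented tuple at a live slot is presented BY THE IDENTITY with these exponents.
-/

set_option linter.dupNamespace false -- mandated namespace of this single-conjunct summit

namespace Summit.ResolutionOfSingularities.ResolutionOfSingularities.Theorems

open Literature.AlgebraicGeometry.Resolution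

namespace TupleMonomialPhase

open MvPowerSeries

variable {k : Type} [Field k] {n e : ℕ}

/-! ### Unit monomials -/

/-- The coefficient of `u · ∏ xᵢ^{vᵢ}` at the exponent `v` is `u(0)`. -/
theorem coeff_unitMonomial_self {m : ℕ} (u : MvPowerSeries (Fin m) k) (v : Fin m → ℕ) :
    coeff (Finsupp.equivFunOnFinite.symm v) (u * ∏ i, X i ^ v i) = constantCoeff u := by
  rw [MonomialWon.prod_X_pow_eq_monomial, coeff_mul_monomial, if_pos le_rfl, tsub_self, coeff_zero_eq_constantCoeff_apply,
    mul_one]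

/-- A unit monomial is non-zero. -/
theorem unitMonomial_ne_zero {m : ℕ} {u : MvPowerSeries (Fin m) k} (hu : constantCoeff u ≠ 0) (v : Fin m → ℕ) :
    u * ∏ i, X i ^ v i ≠ 0 := fun h => by
  have := coeff_unitMonomial_self u v
  rw [h, map_zero] at this
  exact hu this.symm

/-- The order of a unit monomial is at most its total exponent. -/
theorem order_unitMonomial_le {m : ℕ} {u : MvPowerSeries (Fin m) k} (hu : constantCoeff u ≠ 0) (v : Fin m → ℕ) :
    (u * ∏ i, X i ^ v i).order ≤ ((∑ i, v i : ℕ) : ℕ∞) := by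
  have h := order_le (coeff_unitMonomial_self u v ▸ hu : coeff (Finsupp.equivFunOnFinite.symm v) (u * ∏ i, X i ^ v i) ≠ 0)
  refine h.trans (le_of_eq ?_)
  congr 1
  rw [Finsupp.degree_eq_sum]
  simp

/-- The order of a unit monomial is at least its total exponent. -/
theorem le_order_unitMonomial {m : ℕ} (u : MvPowerSeries (Fin m) k) (v : Fin m → ℕ) :
    ((∑ i, v i : ℕ) : ℕ∞) ≤ (u * ∏ i, X i ^ v i).order := by
  rw [MonomialWon.prod_X_pow_eq_monomial]
  have hdeg : ((∑ i, v i : ℕ) : ℕ∞) = ((Finsupp.equivFunOnFinite.symm v).degree : ℕ∞) := by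
    congr 1
    rw [Finsupp.degree_eq_sum]
    simp
  calc ((∑ i, v i : ℕ) : ℕ∞) = (monomial (Finsupp.equivFunOnFinite.symm v) (1 : k)).order := by
        rw [order_monomial_of_ne_zero one_ne_zero, hdeg]
    _ ≤ u.order + (monomial (Finsupp.equivFunOnFinite.symm v) (1 : k)).order := le_add_self
    _ ≤ _ := le_order_mul

/-- Products of unit monomials are unit monomials. -/
theorem unitMonomial_mul {m : ℕ} {f g : MvPowerSeries (Fin m) k}
    (hf : ∃ (u : MvPowerSeries (Fin m) k) (v : Fin m → ℕ), constantCoeff u ≠ 0 ∧ f = u * ∏ i, X i ^ v i)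
    (hg : ∃ (u : MvPowerSeries (Fin m) k) (v : Fin m → ℕ), constantCoeff u ≠ 0 ∧ g = u * ∏ i, X i ^ v i) :
    ∃ (u : MvPowerSeries (Fin m) k) (v : Fin m → ℕ), constantCoeff u ≠ 0 ∧ f * g = u * ∏ i, X i ^ v i := by
  obtain ⟨u, v, hu, rfl⟩ := hf
  obtain ⟨u', v', hu', rfl⟩ := hg
  refine ⟨u * u', v + v', by rw [map_mul]; exact mul_ne_zero hu hu', ?_⟩
  have : ∏ i, (X i : MvPowerSeries (Fin m) k) ^ (v + v') i = (∏ i, X i ^ v i) * ∏ i, X i ^ v' i := by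
    rw [← Finset.prod_mul_distrib]
    exact Finset.prod_congr rfl fun i _ => by rw [Pi.add_apply, pow_add]
  rw [this]; ring

/-- A finite product of unit monomials is a unit monomial. -/
theorem unitMonomial_prod {m : ℕ} {ι : Type} (s : Finset ι) (f : ι → MvPowerSeries (Fin m) k)
    (h : ∀ i ∈ s, ∃ (u : MvPowerSeries (Fin m) k) (v : Fin m → ℕ), constantCoeff u ≠ 0 ∧ f i = u * ∏ i, X i ^ v i) :
    ∃ (u : MvPowerSeries (Fin m) k) (v : Fin m → ℕ), constantCoeff u ≠ 0 ∧ (∏ i ∈ s, f i) = u * ∏ i, X i ^ v i :=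
  Finset.prod_induction f (fun g => ∃ (u : MvPowerSeries (Fin m) k) (v : Fin m → ℕ), constantCoeff u ≠ 0 ∧ g = u * ∏ i, X i ^ v i)
    (fun _ _ hf hg => unitMonomial_mul hf hg) ⟨1, 0, by simp, by simp⟩ h

/-- The identity substitution has an invertible linear part. -/
theorem isUnit_det_X {m : ℕ} :
    IsUnit (Matrix.det (Matrix.of fun i j : Fin m => coeff (Finsupp.single j 1) (X i : MvPowerSeries (Fin m) k))) := by
  have h : (Matrix.of fun i j : Fin m => coeff (Finsupp.single j 1) (X i : MvPowerSeries (Fin m) k)) = 1 := by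
    ext i j
    rw [Matrix.of_apply, coeff_X, Matrix.one_apply]
    by_cases hij : i = j
    · subst hij; simp
    · rw [if_neg (fun h => hij (Finsupp.single_left_injective one_ne_zero h).symm), if_neg hij]
  rw [h, Matrix.det_one]
  exact isUnit_one

/-- A unit monomial has normal-crossing support (identity coordinates). -/
theorem germIsNC_of_unitMonomial {m : ℕ} {g : MvPowerSeries (Fin m) k}
    (hg : ∃ (u : MvPowerSeries (Fin m) k) (v : Fin m → ℕ), constantCoeff u ≠ 0 ∧ g = u * ∏ i, X i ^ v i) :
    TameFourTupleDrop.GermIsNC g := by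
  obtain ⟨u, v, hu, rfl⟩ := hg
  exact ⟨X, u, v, fun i => constantCoeff_X i, isUnit_det_X, hu, by rw [subst_self]; rfl⟩

open scoped Classical in
/-- THE SUPPORT PRODUCT OF A TUPLE OF UNIT MONOMIALS (and zeros) has normal-crossing support. -/
theorem germIsNC_prodSupport {m : ℕ} (b : Fin (e + 1) → MvPowerSeries (Fin m) k)
    (h : ∀ j, b j ≠ 0 → ∃ (u : MvPowerSeries (Fin m) k) (v : Fin m → ℕ), constantCoeff u ≠ 0 ∧ b j = u * ∏ i, X i ^ v i) :
    TameFourTupleDrop.GermIsNC (TupleGame.prodSupport b) := by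
  unfold TupleGame.prodSupport
  refine germIsNC_of_unitMonomial (unitMonomial_prod _ _ fun j _ => ?_)
  split_ifs with hj
  · exact ⟨1, 0, by simp, by simp⟩
  · exact h j hj

/-! ### Presentations -/

open scoped Classical in
/-- PRESENTATIONS EXIST: if the support product of `a` has normal-crossing support in the coordinates `Φ`, every non-zero entry
`a_j∘Φ` is a unit monomial in the SAME coordinates (it divides a unit monomial). -/
theorem exists_presentation {m : ℕ} (a : Fin (e + 1) → MvPowerSeries (Fin m) k)
    (h : TameFourTupleDrop.GermIsNC (TupleGame.prodSupport a)) :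
    ∃ Φ : Fin m → MvPowerSeries (Fin m) k, (∀ i, constantCoeff (Φ i) = 0) ∧
      IsUnit (Matrix.det (Matrix.of fun i j => coeff (Finsupp.single j 1) (Φ i))) ∧
      ∀ j, ∃ v : Fin m → ℕ, a j ≠ 0 → ∃ u : MvPowerSeries (Fin m) k, constantCoeff u ≠ 0 ∧
        subst Φ (a j) = u * ∏ i, X i ^ v i := by
  obtain ⟨Φ, u, v, hΦ0, hdet, hu, hsub⟩ := h
  refine ⟨Φ, hΦ0, hdet, fun j => ?_⟩
  by_cases hj : a j = 0
  · exact ⟨0, fun h => absurd hj h⟩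
  · have hΦ : HasSubst Φ := hasSubst_of_constantCoeff_zero hΦ0
    have hdvd : subst Φ (a j) ∣ u * ∏ i, X i ^ v i := by
      rw [← hsub]
      unfold TupleGame.prodSupport
      rw [← coe_substAlgHom hΦ, map_prod]
      refine dvd_trans ?_ (Finset.dvd_prod_of_mem _ (Finset.mem_univ j))
      simp [hj]
    obtain ⟨u', v', hu', heq⟩ := TrackC.exists_eq_unit_mul_monomial_of_dvd u hu v _ hdvd
    exact ⟨v', fun _ => ⟨u', hu', heq⟩⟩

/-- In a presentation of a BAD tuple the exponents satisfy `m_j ≤ Σᵢ v_{j,i}`. -/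
theorem marking_le_total {m : ℕ} {a : Fin (e + 1) → MvPowerSeries (Fin m) k} (hbad : TupleGame.Bad a)
    {Φ : Fin m → MvPowerSeries (Fin m) k} (hΦ0 : ∀ i, constantCoeff (Φ i) = 0) {j : Fin (e + 1)} (hj : a j ≠ 0)
    {u : MvPowerSeries (Fin m) k} (hu : constantCoeff u ≠ 0) {v : Fin m → ℕ} (h : subst Φ (a j) = u * ∏ i, X i ^ v i) :
    TupleGame.marking e j ≤ ∑ i, v i := by
  have h1 := (hbad j).resolve_left hj
  have h2 := PlaneMonomialPhase.order_le_order_subst Φ hΦ0 (a j)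
  rw [h] at h2
  exact_mod_cast h1.trans (h2.trans (order_unitMonomial_le hu v))

/-- A tuple with a unit-monomial entry of total exponent `< m_j` is not bad. -/
theorem not_bad_of_total_lt {m : ℕ} {b : Fin (e + 1) → MvPowerSeries (Fin m) k} {j : Fin (e + 1)}
    {u : MvPowerSeries (Fin m) k} (hu : constantCoeff u ≠ 0) {v : Fin m → ℕ} (h : b j = u * ∏ i, X i ^ v i)
    (hlt : ∑ i, v i < TupleGame.marking e j) : ¬ TupleGame.Bad b := by
  intro hbad
  rcases hbad j with h0 | hle
  · exact unitMonomial_ne_zero hu v (h ▸ h0)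
  · rw [h] at hle
    have := hle.trans (order_unitMonomial_le hu v)
    exact absurd hlt (not_lt.mpr (by exact_mod_cast this))

/-! ### Unit monomials under the cobordant chart -/

/-- THE TRANSFORM OF A UNIT MONOMIAL: `(u·∏ xᵢ^{vᵢ})(chart_{w,c}) = s^{Σ wᵢ vᵢ} · [u(chart) · ∏ (cᵢ + y′ᵢ)^{vᵢ}]`. -/
theorem subst_chart_unitMonomial (w : Fin n → ℕ) (c : Fin n → k) (hc : ∀ i, w i = 0 → c i = 0)
    (u : MvPowerSeries (Fin n) k) (v : Fin n → ℕ) :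
    subst (CobordantChart.chart w c) (u * ∏ i, X i ^ v i) =
      X 0 ^ (∑ i, w i * v i) * (subst (CobordantChart.chart w c) u * ∏ i, (C (c i) + X i.succ) ^ v i) := by
  have hchs := CobordantChart.hasSubst_chart w c hc
  rw [← coe_substAlgHom hchs, map_mul, map_prod]
  simp_rw [map_pow, coe_substAlgHom, subst_X hchs, CobordantChart.chart_apply, mul_pow, ← pow_mul, Finset.prod_mul_distrib,
    Finset.prod_pow_eq_pow_sum]
  ring

/-- `s ∤ U · ∏ (cᵢ + y′ᵢ)^{vᵢ}` for a unit `U` (`s` is prime and divides no factor). -/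
theorem not_X_dvd_bracket {U : MvPowerSeries (Fin (n + 1)) k} (hU : constantCoeff U ≠ 0) (c : Fin n → k) (v : Fin n → ℕ) :
    ¬ X 0 ∣ U * ∏ i, (C (c i) + X i.succ) ^ v i := by
  classical
  have hp : Prime (X (0 : Fin (n + 1)) : MvPowerSeries (Fin (n + 1)) k) := MvPowerSeries.prime_X' k 0
  have hlin : ∀ (r : k) (i : Fin n), ¬ (X (0 : Fin (n + 1)) : MvPowerSeries (Fin (n + 1)) k) ∣ C r + X i.succ := by
    intro r i h
    rw [X_dvd_iff] at h
    have h0 : (Finsupp.single (i.succ : Fin (n + 1)) 1 : Fin (n + 1) →₀ ℕ) 0 = 0 := by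
      rw [Finsupp.single_apply, if_neg (Fin.succ_ne_zero i)]
    have h1 := h (Finsupp.single i.succ 1) h0
    rw [map_add, coeff_C, coeff_X, if_neg (Finsupp.single_ne_zero.mpr one_ne_zero), if_pos rfl, zero_add] at h1
    exact one_ne_zero h1
  intro h
  rcases hp.dvd_or_dvd h with h1 | h2
  · rw [X_dvd_iff] at h1
    have h0 := h1 0 (Finsupp.zero_apply (a := (0 : Fin (n + 1))))
    rw [coeff_zero_eq_constantCoeff_apply] at h0
    exact hU h0
  · obtain ⟨i, -, hi⟩ := hp.exists_mem_finset_dvd h2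
    exact hlin (c i) i (hp.dvd_of_dvd_pow hi)

/-- The chart substitution does not change constant coefficients. -/
theorem constantCoeff_subst_chart (w : Fin n → ℕ) (c : Fin n → k) (hc : ∀ i, w i = 0 → c i = 0)
    (u : MvPowerSeries (Fin n) k) : constantCoeff (subst (CobordantChart.chart w c) u) = constantCoeff u :=
  constantCoeff_subst_of_constantCoeff_zero _ (CobordantArc.constantCoeff_chart w c hc) u

/-- THE FACTORISATION DATA OF A UNIT MONOMIAL: if `(u·∏ xᵢ^{vᵢ})(chart) = s^D · G` with `u(0) ≠ 0` and `s ∤ G` then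
`D = Σ wᵢ vᵢ` and `G = u(chart) · ∏ (cᵢ + y′ᵢ)^{vᵢ}`. -/
theorem factor_eq (w : Fin n → ℕ) (c : Fin n → k) (hc : ∀ i, w i = 0 → c i = 0)
    {u : MvPowerSeries (Fin n) k} (hu : constantCoeff u ≠ 0) (v : Fin n → ℕ) {D : ℕ} {G : MvPowerSeries (Fin (n + 1)) k}
    (hfac : subst (CobordantChart.chart w c) (u * ∏ i, X i ^ v i) = X 0 ^ D * G) (hG : ¬ X 0 ∣ G) :
    D = ∑ i, w i * v i ∧ G = subst (CobordantChart.chart w c) u * ∏ i, (C (c i) + X i.succ) ^ v i := by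
  rw [subst_chart_unitMonomial w c hc u v] at hfac
  have hU : constantCoeff (subst (CobordantChart.chart w c) u) ≠ 0 := by rwa [constantCoeff_subst_chart w c hc]
  obtain ⟨h1, h2⟩ := X_pow_mul_eq_X_pow_mul 0 hfac (not_X_dvd_bracket hU c v) hG
  exact ⟨h1.symm, h2.symm⟩

/-! ### The slice of the bracket at a live slot -/

/-- The slice fixes `s`. -/
theorem slice_X_zero (l : Fin (n + 1)) :
    TupleGame.slice l (X (0 : Fin (n + 2)) : MvPowerSeries (Fin (n + 2)) k) = X 0 := by
  unfold TupleGame.slice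
  rw [subst_X (CobordantChartPlaneSlice.hasSubst_slice l)]
  have h1 : (0 : Fin (n + 2)) ≠ l.succ := (Fin.succ_ne_zero l).symm
  rw [if_neg h1]
  congr 1

/-- The slice kills `y′_l`. -/
theorem slice_X_succ_self (l : Fin (n + 1)) :
    TupleGame.slice l (X l.succ : MvPowerSeries (Fin (n + 2)) k) = 0 := by
  unfold TupleGame.slice
  rw [subst_X (CobordantChartPlaneSlice.hasSubst_slice l), if_pos rfl]

/-- The slice renumbers `y′_{l.succAbove q}` to `X q.succ`. -/
theorem slice_X_succ_succAbove (l : Fin (n + 1)) (q : Fin n) :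
    TupleGame.slice l (X (l.succAbove q).succ : MvPowerSeries (Fin (n + 2)) k) = X q.succ := by
  unfold TupleGame.slice
  rw [subst_X (CobordantChartPlaneSlice.hasSubst_slice l)]
  have h1 : (l.succAbove q).succ ≠ l.succ := fun h => Fin.succAbove_ne l q (Fin.succ_injective _ h)
  rw [if_neg h1, ← Fin.succ_succAbove_succ, CobordantChartPlaneSlice.predAbove_succ_succAbove]

/-- The slice does not change constant coefficients. -/
theorem constantCoeff_slice (l : Fin (n + 1)) (G : MvPowerSeries (Fin (n + 2)) k) :
    constantCoeff (TupleGame.slice l G) = constantCoeff G :=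
  constantCoeff_subst_of_constantCoeff_zero _ (fun j => by split_ifs <;> simp [constantCoeff_X]) G

/-- The slice is multiplicative. -/
theorem slice_mul (l : Fin (n + 1)) (F G : MvPowerSeries (Fin (n + 2)) k) :
    TupleGame.slice l (F * G) = TupleGame.slice l F * TupleGame.slice l G :=
  subst_mul (CobordantChartPlaneSlice.hasSubst_slice l) F G

/-- The slice is additive. -/
theorem slice_add (l : Fin (n + 1)) (F G : MvPowerSeries (Fin (n + 2)) k) :
    TupleGame.slice l (F + G) = TupleGame.slice l F + TupleGame.slice l G :=
  subst_add (CobordantChartPlaneSlice.hasSubst_slice l) F G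

/-- The slice commutes with powers. -/
theorem slice_pow (l : Fin (n + 1)) (F : MvPowerSeries (Fin (n + 2)) k) (N : ℕ) :
    TupleGame.slice l (F ^ N) = TupleGame.slice l F ^ N :=
  subst_pow (CobordantChartPlaneSlice.hasSubst_slice l) F N

/-- The slice commutes with finite products. -/
theorem slice_prod {ι : Type} [Fintype ι] (l : Fin (n + 1)) (F : ι → MvPowerSeries (Fin (n + 2)) k) :
    TupleGame.slice l (∏ i, F i) = ∏ i, TupleGame.slice l (F i) := by
  unfold TupleGame.slice
  rw [← coe_substAlgHom (CobordantChartPlaneSlice.hasSubst_slice l), map_prod]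

/-- The slice fixes constants. -/
theorem slice_C (l : Fin (n + 1)) (r : k) : TupleGame.slice l (C r : MvPowerSeries (Fin (n + 2)) k) = C r :=
  subst_C r

open scoped Classical in
/-- THE SLICE OF THE BRACKET AT A LIVE SLOT `l` (`c_l ≠ 0`): `[s^N · U · ∏ (cᵢ + y′ᵢ)^{vᵢ}]|_{y′_l = 0}` is the unit monomial with
exponent `N` on `s` and, on the variable `X q.succ` coming from `x_{l.succAbove q}`, the exponent `v` if `c = 0` there and `0` if that
coordinate became a unit. -/
theorem slice_bracket (N : ℕ) {U : MvPowerSeries (Fin (n + 2)) k} (hU : constantCoeff U ≠ 0) (c : Fin (n + 1) → k)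
    {l : Fin (n + 1)} (hcl : c l ≠ 0) (v : Fin (n + 1) → ℕ) :
    ∃ u' : MvPowerSeries (Fin (n + 1)) k, constantCoeff u' ≠ 0 ∧
      TupleGame.slice l (X 0 ^ N * (U * ∏ i, (C (c i) + X i.succ) ^ v i)) =
        u' * ∏ i', X i' ^ (Fin.cases (motive := fun _ => ℕ) N (fun q => if c (l.succAbove q) = 0 then v (l.succAbove q) else 0) i') := by
  have hs := CobordantChartPlaneSlice.hasSubst_slice (R := k) l
  -- the unit factors of the sliced bracket
  set unitq : Fin n → MvPowerSeries (Fin (n + 1)) k := fun q =>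
    if c (l.succAbove q) = 0 then 1 else (C (c (l.succAbove q)) + X q.succ) ^ v (l.succAbove q) with hunitq
  set v' : Fin n → ℕ := fun q => if c (l.succAbove q) = 0 then v (l.succAbove q) else 0 with hv'
  have hfactor : ∀ q : Fin n, TupleGame.slice l ((C (c (l.succAbove q)) + X (l.succAbove q).succ) ^ v (l.succAbove q)) =
      unitq q * X q.succ ^ v' q := by
    intro q
    rw [slice_pow, slice_add, slice_C, slice_X_succ_succAbove]
    simp only [hunitq, hv']
    split_ifs with h0
    · rw [h0, map_zero, zero_add, one_mul]
    · rw [pow_zero, mul_one]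
  have hl : TupleGame.slice l ((C (c l) + X l.succ) ^ v l : MvPowerSeries (Fin (n + 2)) k) = C (c l ^ v l) := by
    rw [slice_pow, slice_add, slice_C, slice_X_succ_self, add_zero, ← map_pow]
  refine ⟨TupleGame.slice l U * C (c l ^ v l) * ∏ q, unitq q, ?_, ?_⟩
  · rw [map_mul, map_mul, constantCoeff_slice, constantCoeff_C, map_prod]
    refine mul_ne_zero (mul_ne_zero hU (pow_ne_zero _ hcl)) (Finset.prod_ne_zero_iff.mpr fun q _ => ?_)
    simp only [hunitq]
    split_ifs with h0
    · simp
    · rw [map_pow, map_add, constantCoeff_C, constantCoeff_X, add_zero]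
      exact pow_ne_zero _ h0
  · rw [slice_mul, slice_mul, slice_pow, slice_X_zero, slice_prod, Fin.prod_univ_succAbove _ l, hl]
    simp_rw [hfactor]
    rw [Finset.prod_mul_distrib, Fin.prod_univ_succ]
    simp only [Fin.cases_zero, Fin.cases_succ]
    ring

/-! ### The successor tuple of a presented tuple -/

open scoped Classical in
/-- THE SUCCESSOR AT A LIVE SLOT of a presented tuple.  Presentation: `a_j∘Φ = u_j · ∏ xᵢ^{v_{j,i}}` for the non-zero entries; move: the
centre `{xᵢ = 0 : i ∈ J}` (weights `wᵢ = 1` on `J`, `0` off `J`), exceptional point `c` (`cᵢ = 0` off `J`), live slot `l` (`c_l ≠ 0`);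
factorisation data `(D_j, G_j)`.  Then `D_j = Σ_{i ∈ J} v_{j,i}` and the successor entry `j` is a unit monomial, presented by the identity,
with exponents: `D_j − m_j·W` on `s`; on the variable from `x_{l.succAbove q}` the old exponent if `c = 0` there, else `0`. -/
theorem newTuple_slot {a : Fin (e + 1) → MvPowerSeries (Fin (n + 1)) k} {Φ : Fin (n + 1) → MvPowerSeries (Fin (n + 1)) k}
    {v : Fin (e + 1) → Fin (n + 1) → ℕ}
    (hpres : ∀ j, a j ≠ 0 → ∃ u : MvPowerSeries (Fin (n + 1)) k, constantCoeff u ≠ 0 ∧ subst Φ (a j) = u * ∏ i, X i ^ v j i)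
    (J : Finset (Fin (n + 1))) (c : Fin (n + 1) → k) (hc : ∀ i, (if i ∈ J then 1 else 0) = 0 → c i = 0)
    {l : Fin (n + 1)} (hcl : c l ≠ 0) (D : Fin (e + 1) → ℕ) (G : Fin (e + 1) → MvPowerSeries (Fin (n + 2)) k)
    (hfac : ∀ j, a j ≠ 0 → subst (CobordantChart.chart (fun i => if i ∈ J then 1 else 0) c) (subst Φ (a j)) = X 0 ^ D j * G j ∧
      ¬ X 0 ∣ G j) :
    ∀ j, a j ≠ 0 → D j = ∑ i ∈ J, v j i ∧ ∃ u' : MvPowerSeries (Fin (n + 1)) k, constantCoeff u' ≠ 0 ∧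
      TupleGame.newTuple a D G l j = u' * ∏ i', X i' ^
        (Fin.cases (motive := fun _ => ℕ) (D j - TupleGame.marking e j * TupleGame.floorWeight a D)
          (fun q => if c (l.succAbove q) = 0 then v j (l.succAbove q) else 0) i') := by
  intro j hj
  obtain ⟨u, hu, hju⟩ := hpres j hj
  obtain ⟨hfacj, hGj⟩ := hfac j hj
  rw [hju] at hfacj
  obtain ⟨hD, hG⟩ := factor_eq _ c hc hu (v j) hfacj hGj
  have hD' : D j = ∑ i ∈ J, v j i := by
    rw [hD, ← Finset.sum_filter_add_sum_filter_not Finset.univ (fun i => i ∈ J)]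
    rw [Finset.sum_eq_zero (s := Finset.univ.filter fun i => ¬ i ∈ J) (fun i hi => by
      rw [Finset.mem_filter] at hi; rw [if_neg hi.2, zero_mul]), add_zero]
    rw [Finset.filter_mem_eq_inter, Finset.univ_inter]
    exact Finset.sum_congr rfl fun i hi => by rw [if_pos hi, one_mul]
  refine ⟨hD', ?_⟩
  have hU : constantCoeff (subst (CobordantChart.chart (fun i => if i ∈ J then 1 else 0) c) u) ≠ 0 := by
    rwa [constantCoeff_subst_chart _ c hc]
  obtain ⟨u', hu', hslice⟩ := slice_bracket (D j - TupleGame.marking e j * TupleGame.floorWeight a D) hU c hcl (v j)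
  refine ⟨u', hu', ?_⟩
  unfold TupleGame.newTuple
  rw [if_neg hj, hG]
  exact hslice

end TupleMonomialPhase

end Summit.ResolutionOfSingularities.ResolutionOfSingularities.Theorems
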